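import Mathlib
import HarnessLib
import HarnessLib.Audit
import Summits.HubbardSuperconductivity.Statement
import Literature.Barriers.HubbardSuperconductivity.HohenbergMerminWagnerPairing

/-!
Route: KineticMerminWagner

CLOSED (retired) 2026-08-15T13:48:19Z by operator:999:1257524 — reason: not-a-thesis: assembly does not conclude the sub-problem Statement — note: D-0027 §2.1 audit (human 2026-08-15: routes that do not decide the summit are removed): the assembly concludes `KineticMerminWagnerLaw`, not the sub-problem statement; a NEW conforming route may be opened from the same idea (generated `closes : … → _root_.HubbardSuperconductivity`).. The file is kept as the record of this route; refuted decls are indexed as negative knowledge (`ledger negatives`).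

# Route KineticMerminWagner — Mermin–Wagner runs on kinetic energy — Peierls–Bogoliubov-sharpened
Koma–Tasaki decay with thermodynamic exponent c·T/(t·k(β)); Uemura (T/tδ) and Heisenberg (T/J)
scalings (ceiling route)

KIND: CEILING / CALIBRATION ROUTE (as MottCornerCeiling). It proves neither S nor ¬S and does not
pretend to: the Assembly concludes the route
target `KineticMerminWagnerLaw`, not the constant `HubbardSuperconductivity` — an upper bound on
THERMAL pair correlations cannot bear on a
T = 0 every-ground-state statement (f → 0 as β → ∞), and dressing it as either side would be a
costume. Its deliverables are theorems in
Theorems/ that (i) sharpen the catalogue's least-engaged barrier (HohenbergMerminWagnerPairing /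
PositiveTemperatureNoPairLRO, whose tree
exponent f = (2+128β|t|)/(1+128β|t|)² depends on the hopping MATRIX only) into a STATE-DEPENDENT,
doping- and U-resolved exponent, (ii) give
every T > 0 foothold of the sub (SpinStructureRigidity at β = κL, ThermalWedge, AbelianDuality,
high-T-series cards) a quantitative map of where
algebraic d-wave pair order may live, (iii) land two reusable tools (Peierls–Bogoliubov; the
partition-function form of the Koma–Tasaki gauge
bound) and one thermodynamic inequality of independent interest (the bond kinetic energy of the
strongly repulsive Gibbs state is
O(|δ| + t/U + √(T/U)), uniformly in L). Realises idea card kinetic-mermin-wagner-uemura-ceiling-v2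
(audited new-combination).
X (it suffices to show) = KineticMerminWagnerLaw: there are U₀ and C₀ > 0 such that for every form
factor g, every U ≥ U₀ (t = 1), every
β > 0, all chemical potentials μ outside a countable set S(U,β) (first-order coexistence points
excepted), there is C = C(g,U,β,μ) with,
for EVERY side L ≥ 1 and all x, y ∈ (ℤ/Lℤ)²,
  |re ⟨(P_x)† P_y⟩_{β,L,μ}| ≤ C · (dist(x,y) + 1)^{−f(β k_L/2)},   k_L := min(2, C₀(|δ_L| + 1/U +
(T/U)^{1/2})),
where P_x = localPair g L x, ⟨·⟩ is the grand-canonical Gibbs state of hubbardTorusWith 2 L 1 U μ,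
δ_L := 1 − ⟨N̂⟩_{β,L,μ}/L² is ITS hole
doping and f = pairDecayExponent (so f(b) ≈ 1/(128 b) for b ≫ 1 and the tree's Koma–Tasaki is the
case k_L = 2). Reading: the 2D Hubbard
pair-correlation decay exponent is ≥ c·T/(t·k), k the bond kinetic energy the electrons actually
have — η ≳ c T/(tδ) in the doped Mott
regime (Uemura scaling: Mermin–Wagner bites harder the LOWER the doping), η ≳ c T U/t² = c′T/J at
half filling (Heisenberg scaling read off
the Hubbard Hamiltonian), Koma–Tasaki in the band metal. Corollary (prose, not filed):
quasi-long-range pair order with exponent η₀ (1/4 at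
a BKT point) at (U ≥ U₀, μ ∉ S) forces T ≲ C(η₀)(t|δ| + t²/U) — a rigorous
Uemura/Emery–Kivelson-type thermal ceiling with no
Nelson–Kosterlitz, stiffness or quasiparticle input (constants honest-but-poor: a scaling-law
theorem, not a useful number).
Lean: `open Literature.MathematicalPhysics.QuantumLattice
Literature.Barriers.HubbardSuperconductivity Literature.Probability.LatticeModels in ∃ U₀ C₀ : ℝ, 0
< C₀ ∧ ∀ (g : Site 2 → ℝ) (U β : ℝ), U₀ ≤ U → 0 < β → ∃ S : Set ℝ, S.Countable ∧ ∀ μ : ℝ, μ ∉ S → ∃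
C : ℝ, ∀ (L : ℕ) [NeZero L] (x y : TorusSite 2 L), |thermalPairFieldCorr g β 1 U μ L x y| ≤ C *
((torusDist x y : ℝ) + 1) ^ (-pairDecayExponent (β / 2 * min 2 (C₀ * (|1 - (Matrix.gibbsState β
(hubbardTorusWith 2 L 1 U μ) totalNumber).re / (L : ℝ) ^ 2| + 1 / U + Real.sqrt (1 / (β * U))))))`

## Assembly
Bookkeeping, modulo the three inputs (the glue re-runs the barrier file's
norm_thermalCorr_bondPair_torus_le with two lines changed): write
(P_x)†P_y as the g-weighted sum of bond-pair products (thermalCorr_localPair_eq); for each,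
GaugeRatioBound with D = siteGauge φ (radial
potential centred at y, radius R = dist(x,y), charge q ≤ 1: eigenvalue e^{−(φ_x+φ_x′)+(φ_y+φ_y′)} ≤
e^{2q−2qH(R)}, Hermitian part H + V_φ by
siteGauge_conj_hamiltonianWith_add_conjTranspose) gives |⟨·⟩| ≤ 4e^{2q} e^{−2qH(R)} Z(K_φ)/Z(H);
DeformationFreeEnergy with
k := min(2, C₁(|δ_L| + 1/U + √(T/U))) (admissible by ‖Σ_σ c†c‖ ≤ 2 and ThermalKineticCeiling) and
Σ_{u∼v} w ≤ 64q²H(R), Σ w² ≤ C_abs q⁴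
(cosh s − 1 ≤ s², shell count 4(2r+1), Σ r·r⁻⁴ < ∞) bounds log Z(K_φ) − log Z(H) ≤ 64βk q²H(R) + C′;
optimise q = 1/(1 + 64βk) exactly as in
koma_tasaki_2d_holds (B = 64βk = 128·(βk/2)) and use H(R) ≥ log(1+R): exponent
pairDecayExponent(βk/2), prefactor C = C_g e^{2+C′};
U₀ := max of the two thresholds, C₀ := C₁, S := the exceptional set of DeformationFreeEnergy.

UNDER FLOOR: fewer than 2 cruxes remain after retriage (legacy route; D-0019).

Rationale: WHY THIS LINE. The tree's Koma–Tasaki/McBryan–Spencer proof (norm_gibbsState_le_of_gauge,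
koma_tasaki_2d_holds, the barrier file's bond-pair extension)
pays the whole Mermin–Wagner cost as ‖e^{−βV_φ}‖ ≤ e^{β‖V_φ‖}, an operator NORM blind to the state,
so its exponent ∝ 1/(β|t|) sees the
bandwidth, not the physics. Two textbook convexity facts change that: (M1) Schwarz + Bernstein
already bound |Tr A e^{−βGHG⁻¹}| by the
partition function of the HERMITIAN PART H + V_φ (printed in FrohlichUeltschi2015 =
doi:10.1063/1.4921305 and BenassiFroehlichUeltschi2016 =
arXiv:1612.02478, who then take the norm step), and (M2) Peierls–Bogoliubov AT THE DEFORMED POINT,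
Z(H+V_φ)/Z(H) ≤ exp(−β⟨V_φ⟩_{H+V_φ})
(Ruelle1969, Simon1993), turns the cost into β t Σ_b w_b ⟨hop_b⟩ — the bond kinetic EXPECTATION, a
thermodynamic quantity. The second
import is an elementary strong-coupling floor replacing the Datta–Fernández–Fröhlich expansion
(DattaFernandezFrohlich1999; barrier
StrongCouplingCeiling): grade the hopping by doublon number, Schur-test the doublon-preserving part
(T₀ ≥ −4t(Ê + D̂)), complete the square
bondwise on the doublon-changing part (X_b + X_b† ≥ −aX_b†X_b − 1/a, X_b†X_b ≤ 16t²(D_u + D_v)),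
giving H ≥ −4t(L² − N̂) + (U/2 − 8t)D̂ −
256t²L²/U, whence by the Gibbs variational principle and S ≤ L² ln 4 a thermal doublon budget d ≤
(4t|δ| + T ln 4 + 256t²/U)/(U/2 − 8t) and,
through a hole/doublon-conditioned Cauchy–Schwarz bound on ⟨c†_{uσ}c_{vσ}⟩, the kinetic ceiling k ≤
C₁(|δ| + t/U + √(T/U)) (Gutzwiller's
g_t ∝ δ, ZhangGrosRiceShiba1988; stiffness analogue HazraVermaRanderia2019; phenomenology
UemuraEtAl1989 = doi:10.1103/physrevlett.62.2317,
EmeryKivelson1995 = doi:10.1038/374434a0). Areas imported: matrix trace/convexity inequalities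
(Peierls–Bogoliubov, Bernstein), classical
McBryan–Spencer complex rotation (McBryanSpencer1977), strong-coupling operator inequalities; what
no prior route or the negatives index
(empty) does: make the T > 0 obstruction quantitative in (δ, U, T) instead of dismissing it as "T =
0, not met".

RANKED CRUXES. #0 KineticMerminWagnerLaw (target) — X as in § Thesis: for U ≥ U₀, β > 0, μ outside a
countable S(U,β), the thermal pair-field correlations of every form factor g decay at least like
(dist+1)^{−f(β k_L/2)} with k_L = min(2, C₀(|δ_L| + 1/U + √(T/U))), uniformly in L (prefactor
C(g,U,β,μ)). (why it might fail: Only through DeformationFreeEnergy (homogenization of the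
deformation free energy: open wherever βt is not ≪ 1); with crude constants (128, C₁ ≈ 260) the law
beats Koma–Tasaki only for |δ| + 1/U + √(T/U) ≲ 10⁻²: a scaling theorem, numerically poor.)
[KomaTasakiPRL1992, McBryanSpencer1977, BenassiFroehlichUeltschi2016, HazraVermaRanderia2019,
UemuraEtAl1989]
#2 DeformationFreeEnergy (crux) — HOMOGENIZATION (card K1/Theorem 2, in the weakest form the
assembly needs): for U ≥ U₀, β > 0 and μ outside a countable set there is C such that for every side
L, every k bounding the undeformed bond kinetic expectations ‖⟨Σ_σ c†_{uσ}c_{vσ}⟩_{β,L,μ}‖ ≤ k on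
adjacent (u,v), and every site function φ with |φ_u − φ_v| ≤ 1 on edges, the cosh-enhanced-hopping
model K_φ = H − T(cosh∇φ − 1) satisfies log Z(K_φ) − log Z(H) ≤ β·k·Σ_{u∼v}(cosh(φ_u−φ_v) − 1) + C(1
+ Σ_{u∼v}(cosh(φ_u−φ_v) − 1)²): the deformation costs free energy at the rate of the HOMOGENEOUS
kinetic budget, up to an R-independent remainder (for the radial test potentials Σw ~ q² log R but
Σw² = O(q⁴)). Attack lines: (a) Duhamel to second order, remainder ≤ β²χ Σw²/2 with χ the ℓ¹-norm of
the connected bond–bond Duhamel function along H + sV_φ (converges even at a power-law critical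
point because w_b ~ q²/r²); (b) endpoint Peierls–Bogoliubov + local KMS/energy–entropy-balance
bounds on doublons and doublon–hole pairs of the deformed state + "no mesoscopic hole accumulation
at the vortex cores" (finite compressibility). [difficulty: open-problem] (why it might fail: Needs
finite compressibility and summable bond-kinetic response of the DEFORMED Gibbs states, uniformly in
L, at the given (β,U,μ): no theorem beyond βt ≪ 1 (where the gain is invisible); a coexistence
REGION in μ (not isolated points) or hole pile-up at the cores breaks slope k.) [KomaTasakiPRL1992,
McBryanSpencer1977, BenassiFroehlichUeltschi2016, EmeryKivelsonLin1990, Ueltschi1999,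
BratteliRobinsonII1997]
#3 ThermalKineticCeiling (crux) — THERMAL KINETIC CEILING (card Theorem 3, both signs of doping,
every L, grand-canonical): there are U₀, C₁ with ‖⟨Σ_σ c†_{uσ}c_{vσ}⟩_{β,L,μ}‖ ≤ C₁(|δ_L| + 1/U +
(1/(βU))^{1/2}) for all U ≥ U₀ (t = 1), μ, β > 0, L and adjacent (u,v), δ_L = 1 − ⟨N̂⟩/L². Sketch:
(i) per bond and spin, split c†_{uσ}c_{vσ} by the σ̄-occupations of u,v (four commuting channels:
hole moves, doublon moves, pair creation, pair annihilation) and Cauchy–Schwarz with the pre/post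
projectors: |⟨c†_{uσ}c_{vσ}⟩| ≤ (h_u+h_v)/2 + (d_u+d_v)/2 + √⟨D_u h_v⟩ + √⟨h_u D_v⟩ in ANY state;
(ii) h = 1 − n + d sitewise; (iii) operator floor H ≥ −4(L² − N̂) + (U/2 − 8)D̂ − 256L²/U (doublon
grading of the hopping: Schur test T₀ ≥ −4(Ê + D̂) on each (N,D) block; bondwise X_b + X_b† ≥
−aX_b†X_b − 1/a with X_b†X_b ≤ 16(D_u+D_v), a = U/128) and its particle–hole mirror H ≥ (U−4)(N̂ −
L²) + (U/2 − 8)Ê − 256L²/U; (iv) Gibbs variational principle against the atomic limit, F(K) ≤ F(K₀)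
≤ −μ⟨N̂⟩ + U(⟨N̂⟩ − L²)⁺ (Peierls–Bogoliubov with ⟨T̂⟩_{K₀} = 0, then z₀ ≥ each of its terms), and
S(ω) ≤ L² ln 4 ⇒ d (resp. h) ≤ (4|δ_L| + T ln 4 + 256/U)/(U/2 − 8); (v) translation invariance of
the torus Gibbs state turns site/bond quantities into densities; AM–GM absorbs √(δ/U) ≤ (δ + 1/U)/2.
U₀ = 32, C₁ ≈ 264 work on paper. [deps: PeierlsBogoliubov] [difficulty: L] (why it might fail: The
δ-LINEAR law needs the doublon grading with pre/post projectors placed right in all four channels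
(else only √δ survives), the Schur floor on each (N,D) block, the bondwise square completion at U ≥
32t, and torus translation invariance of the fermionic Gibbs state (JW signs).)
[HazraVermaRanderia2019, ZhangGrosRiceShiba1988, Tasaki1998, DattaFernandezFrohlich1999,
EmeryKivelson1995, UemuraEtAl1989]
#4 KineticKomaTasaki (crux) — KINETIC KOMA–TASAKI (card Theorem 1, unconditional): for every form
factor g, all t, U, μ, β ≥ 0, every side L and every k ≥ 0 bounding the bond kinetic expectations
‖⟨Σ_σ c†_{uσ}c_{vσ}⟩‖ of the Gibbs states of ALL cosh-deformed Hamiltonians H − tT(cosh∇φ − 1) with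
|∇φ| ≤ 1 on edges: |⟨(P_x)†P_y⟩_{β,L}| ≤ C_g (dist(x,y)+1)^{−f(β|t|k/2)} with the tree's C_g =
pairFieldDecayConst g and f = pairDecayExponent (k = 2 is the tree's theorem; every kinetic ceiling
on the deformed family improves the EXPONENT proportionally). Proof: GaugeRatioBound +
PeierlsBogoliubov in place of ‖e^{−βV}‖ ≤ e^{β‖V‖} inside the barrier file's
norm_thermalCorr_bondPair_torus_le (radial potential: φ_x − φ_y = qH(R), Σ_{u∼v} w ≤ 64q²H(R), |∇φ|
≤ q ≤ 1), then −β⟨V_φ⟩_{K_φ} = βt Σ_{u∼v} w(u,v) re⟨Σ_σ c†_u c_v⟩_{K_φ} ≤ β|t| k Σ w. [deps: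
GaugeRatioBound, PeierlsBogoliubov] [difficulty: M] (why it might fail: True unless mis-stated: PB
needs H − tT(w) Hermitian (w symmetric) and the sign −β·re⟨V_φ⟩ at the DEFORMED state; ordered-pair
bookkeeping fixes b = β|t|k/2 (k = 2 must recover the tree); the radial potential's gradient ≤ 1
needs q ≤ 1 and the 1-Lipschitz torus norm.) [KomaTasakiPRL1992, FrohlichUeltschi2015,
BenassiFroehlichUeltschi2016, McBryanSpencer1977, Ruelle1969]
#9 GaugeRatioBound (support) — (M1, partition-function form of the Koma–Tasaki gauge bound; the
tree's norm_gibbsState_le_of_gauge stopped one step earlier) H Hermitian, D invertible, DAD⁻¹ = κA,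
DHD⁻¹ + (DHD⁻¹)ᴴ = 2(H + V), β ≥ 0 ⇒ ‖⟨A⟩_{β,H}‖·Z(H) ≤ |κ|‖A‖·Z(H+V) (trace cyclicity + Schwarz +
Bernstein Tr e^X e^{Xᴴ} ≤ Tr e^{X+Xᴴ}: the anti-Hermitian part is deleted exactly; the intermediate
`have`s of norm_trace_mul_exp_le_of_hermitianPart_le, exported). [difficulty: provable-now]
[KomaTasakiPRL1992, FrohlichUeltschi2015, Bernstein2009, Petz1994]
#9 PeierlsBogoliubov (support) — (M2) Peierls–Bogoliubov / Gibbs–Bogoliubov inequality for Hermitian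
matrices: Z_β(H+V) ≤ Z_β(H)·exp(−β re⟨V⟩_{β,H+V}) (Peierls' Tr e^M ≥ Σ_i e^{⟨i|M|i⟩} in the
eigenbasis of H+V, then Jensen). Used by KineticKomaTasaki, by ThermalKineticCeiling (F(K) ≤ F(K₀)),
and by attack (b) on DeformationFreeEnergy; reusable by ThermalWedge-type routes. [difficulty:
provable-now] [Ruelle1969, Simon1993, BratteliRobinsonII1997]

TWO-LAYER PLAN. Foreseen glued splits (filed only after a crux closes or stalls with a census):
DeformationFreeEnergy ⇐ NoHoleAccumulation (w-weighted
empty-site density of the deformed Gibbs state ≤ (δ_L + d)Σw + C(1+Σw²): finite-compressibility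
statement) → LocalDoublonPairBound (KMS /
energy–entropy balance: ⟨D_u⟩, ⟨D_u h_v⟩ of ANY Gibbs state of a Hubbard Hamiltonian with hoppings
in [t, t cosh 1] are ≤ C t/(U−μ) + e^{−β(U−μ)/2}
locally, dressed to (t/U)²; no clustering) → DeformationFreeEnergy (glue: endpoint PB + the channel
bound of Theorem 3 (i)). ThermalKineticCeiling
⇐ BondKineticOperatorBound (Theorem 3 (i), every state) → ThermalDoublonBudget (both signs,
grand-canonical) → ThermalKineticCeiling (glue:
translation invariance). KineticKomaTasaki needs no split.

KILL CRITERIA. DeformationFreeEnergy refuted (a parameter point U ≥ U₀, μ-interval, β with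
super-O(1) remainder — in practice a phase-coexistence theorem) ⇒ the
LAW dies at that generality: close `refuted:DeformationFreeEnergy` unless the refutation is an
isolated μ (then restate with the witness in S);
KineticKomaTasaki and ThermalKineticCeiling survive as catalogue facts (keep wanted as supports of
the barrier files). ThermalKineticCeiling refuted
(a strongly repulsive Gibbs state with bond kinetic expectation ≫ |δ| + 1/U + √(T/U)) ⇒ pivot the
target to the √-law k ≤ C(|δ| + (t/U)^{1/2} +
(T/U)^{1/2}) (crude doublon budget, MottCornerCeiling-type) by --restate. KineticKomaTasaki or a
support refuted ⇒ a typing error: restate. A proof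
elsewhere of thermal d-wave quasi-LRO at some T > C(|δ| + 1/U) would contradict the law +
DeformationFreeEnergy there and locate S.

NOT DECOMPOSED YET. The canonical (N_L, S^z = 0)-sector version (block compression Matrix.toBlock;
the gauge is diagonal so everything restricts, but the trace
toolkit must be re-run on blocks); the transverse-SPIN version (S^z gauge, cosh(∇φ/2), charge 1:
η_spin ≥ c′T/J at half filling as a theorem on
thermalSpinCorr — same two cruxes); sharp constants (Koma–Tasaki's optimised α f(β),
McBryan–Spencer's refined potential, the activated doublon
bound e^{−β(U−ct)} via energy–entropy balance) — they change numbers, not the structure; the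
Uemura-ceiling corollary (quasi-LRO with exponent
η₀ ⇒ limsup-type temperature bound), filed when the law closes; torus translation invariance of the
fermionic Gibbs state and ‖Σ_σ c†c‖ ≤ 2
(helper lemmas, ride with --supports); any attempt to reach T = 0 (none is claimed).

CHEAPEST FALSIFIER. (1) Directions of the two matrix inequalities: a 4×4 random-Hermitian check of
PeierlsBogoliubov (Z(H+V) ≤ Z(H)e^{−β⟨V⟩_{H+V}}) and of
GaugeRatioBound with D = e^{diag} — instant if mis-stated (both are textbook; 1×1 case is equality).
(2) DeformationFreeEnergy at U = 0, where
everything is a determinant: compute log det(1+e^{−β(h−μ+v_φ)}) − log det(1+e^{−β(h−μ)}) for the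
radial potential, R ≤ 100, L ≤ 256, β ∈ {5, 20},
q = 1, and check that (difference − βk_free Σw) stays bounded in R (free fermions cluster; a log R
drift would kill the FORM of the crux, not just
its proof). (3) ThermalKineticCeiling against published DQMC/NLCE bond kinetic energies at U = 8, T
= 0.25–1: they are ≈ linear in δ plus J-
and T-offsets, far below 12δ + 264/U + 32√(T/U); an excess would mean a mis-booked channel in (i).
Not run here (hub compute-free; lit/kit
daemons unavailable this session) — refuters please run (1)–(2) first.

NUMBERS. Tree: f = pairDecayExponent b = (2+128b)/(1+128b)², b = β|t| (koma_tasaki_2d_holds;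
HohenbergMerminWagnerPairing), C_g = 4e²(Σ_e|g e|/√2)²
(= 32e² for dWaveFormFactor); here b = β|t|k/2, k ≤ 2 always. Free band, half filling, T = 0:
E_kin/site = −16t/π² ≈ −1.62t ⇒ per ordered
pair k ≈ 0.41. Gutzwiller: kinetic ∝ g_t = 2δ/(1+δ) (ZhangGrosRiceShiba1988). Paper constants of
crux 3: U₀ = 32t, d ≤ (4t|δ| + T ln 4 +
256t²/U)/(U/2 − 8t), k ≤ 12|δ| + 264 t/U + 32√(T/U) (T ≤ U). Cluster-expansion radius where
DeformationFreeEnergy is provable today: βt < τ₀ =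
(4e⁶·2178)⁻¹ ≈ 2.8·10⁻⁷ (HubbardLatticeActivity.tau0) — there f ≈ 2 already, so the gain is
invisible: the crux matters exactly outside it.
Items at open: 7 (target, assembly, 3 cruxes, 2 supports).

DEFINITION REQUESTS. None. Every constant exists: Matrix.gibbsState / partitionFn / thermalCorr,
Literature.MathematicalPhysics.QuantumLattice.{hubbardTorusWith,
hoppingForm, fermionTorusGraph, FermionTorus, creation, annihilation, orb, totalNumber, localPair,
torusDist},
Literature.Barriers.HubbardSuperconductivity.{thermalPairFieldCorr, pairDecayExponent,
pairFieldDecayConst} (all `lean check` rc 0 in Sketch.lean).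
Bib entries BenassiFroehlichUeltschi2016 (arXiv:1612.02478), FrohlichUeltschi2015
(doi:10.1063/1.4921305), UemuraEtAl1989, EmeryKivelson1995
were added to references.bib by this planner (ledger bib add, commit d31f70ff7de5).

Novelty: Searches (2026-08-15): `lit search "Peierls-Bogoliubov inequality Koma Tasaki decay correlations
Hubbard kinetic energy exponent"` and `lit search
"Mermin-Wagner Hubbard model decay of correlations kinetic energy doping dependence exponent"` (both
rc 75, searchd unavailable this session —
recorded for the auditor to re-run); `lit frontier HubbardSuperconductivity --since 2020` (30 rows:
DMFT analysis, bootstrap, NQS, frustration-free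
fermions, mean-field AF gap, fRG, PDW numerics — nothing on Mermin–Wagner exponents or
kinetic-energy control of decay); `lit cite` lookups
arXiv:1612.02478, doi:10.1063/1.4921305, doi:10.1103/physrevlett.62.2317, doi:10.1038/374434a0
(found); `ledger negatives` (0); the card's audited
searches (crossref ×4; the refuter READ BenassiFroehlichUeltschi2016 p. 8: Trotter+Hölder deletes
the anti-Hermitian part, then the NORM step
e^{β‖C‖}); tree files HubbardHubbardModelPairDecayProofs, TraceInequalitiesProofs,
HohenbergMerminWagnerPairing (norm-based throughout); all 42
route files of the sub (27 mention Koma–Tasaki/Mermin–Wagner, all only in barrier lines; none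
sharpens the exponent).
Nearest prior art found: KomaTasakiPRL1992 (arXiv:cond-mat/9709068; engine, exponent ∝ 1/(β|t|));
McBryanSpencer1977; FrohlichUeltschi2015
(doi:10.1063/1.4921305) and BenassiFroehlichUeltschi2016 (arXiv:1612.02478) — M1 in print, norm step
afterwards; SuSuzuki1998 (Bogoliubov
inequality: the double commutator IS the bond kinetic energy, but no decay rate); HazraVermaRa  [refs: 10.1063/1.4921305, 10.1103/physrevlett.62.2317, 10.1038/374434a0, 1612.02478, cond-mat/9709068, doi:10.1063/1.4921305, doi:10.1103/physrevlett.62.2317, doi:10.1038/374434a0, BenassiFroehlichUeltschi2016, KomaTasakiPRL1992, McBryanSpencer1977, FrohlichUeltschi2015, SuSuzuki1998, HazraVermaRanderia2019, ParamekantiTrivediRanderia1998, DattaFernandezFrohlich1999]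

Barriers (technique_class: positive-temperature-methods; Peierls-Bogoliubov): - technique_class: positive-temperature-methods; Peierls-Bogoliubov
- Literature.Barriers.HubbardSuperconductivity.HohenbergMerminWagnerPairing: it does not evade it
and does not try — the route is INSIDE the class deliberately (obstruction-first sharpening): it
asserts no T > 0 order, only a sharper, state-dependent decay bound for the very object
(thermalPairFieldCorr g) the barrier file bounds, upgrading its scope_caveats ("constants far from
optimal", exponent a function of β|t| only) to a (δ, U, T)-resolved exponent; evasions_known (i)–(v)
untouched.
- Literature.Barriers.HubbardSuperconductivity.PositiveTemperatureNoPairLRO: same — consistent with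
and strictly sharper than PositiveTemperatureNoPairLRO_holds; nothing is claimed at T = 0 (evasion
(i) is the summit's business, not this route's).
- Literature.Barriers.HubbardSuperconductivity.StrongCouplingCeiling: evaded — no t/U or cluster
expansion of the STATE is used; the only strong-coupling input is an operator inequality
(doublon-graded hopping floor) valid for the SU(2)-symmetric model at every temperature and filling,
plus convexity; the barrier's "no low-temperature phase control" is respected because the Gibbs
state is never expanded (the price is crux 2, a locality hypothesis, stated openly).
- Literature.Barriers.HubbardSuperconductivity.LROForcesLowLyingStates: not used; compatible (the
same expectation-for-norm move would sharpen its constant c₀, recorded under Not decomposed yet).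
- Literature.Barriers.Hubb

History (route lifecycle, newest last):
- 2026-08-15T13:48:19Z · CLOSED retired — not-a-thesis: assembly does not conclude the sub-problem Statement (operator:999:1257524)

sub-problem: HubbardSuperconductivity · status: closed(retired) · opened planner-plancard-HubbardSuperconductivity-Hub-07b63e8c-0 2026-08-15T12:36:34Z · rev 1 · ledger route-HubbardSuperconductivity-KineticMerminWagner
GENERATED by the gate from the ledger (D-0016/17). Provers cite these decls: `theorem foo : Summit.HubbardSuperconductivity.HubbardSuperconductivity.Theses.KineticMerminWagner.<Decl> := …` in Summits/HubbardSuperconductivity/HubbardSuperconductivity/Theorems/<Name>.lean.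
-/

namespace Summit.HubbardSuperconductivity.HubbardSuperconductivity.Theses.KineticMerminWagner

open scoped BigOperators Topology Manifold Classical MeasureTheory ProbabilityTheory Matrix InnerProductSpace ComplexConjugate ContinuousMap
open Filter Set Function TopologicalSpace MeasureTheory

attribute [summit_statement] _root_.HubbardSuperconductivity

open Literature.Hubbard

/-- item stmt-HubbardSuperconductivity-8292 · target · rank 0 · closed · moot by None · by planner
why it might fail: Reachable only via DeformationFreeEnergy; inherits 'countable exceptional μ at each (U,β)': a floating-stripe/coexistence μ-window at low T (arXiv:2009.10736) breaks it; δ_L is the GC-average doping: minority high-doping components must be L-suppressed; beats Koma–Tasaki only if |δ|+1/U+√(T/U)≲1e-2.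
sources: KomaTasakiPRL1992, McBryanSpencer1977, arXiv:2009.10736, EmeryKivelsonLin1990, HazraVermaRanderia2019, UemuraEtAl1989
[target] X as in § Thesis: for U ≥ U₀, β > 0, μ outside a countable S(U,β), the thermal pair-field
correlations of every form factor g decay at least like (dist+1)^{−f(β k_L/2)} with k_L = min(2,
C₀(|δ_L| + 1/U + √(T/U))), uniformly in L (prefactor C(g,U,β,μ)). -/
@[route_item "route-HubbardSuperconductivity-KineticMerminWagner"]
def KineticMerminWagnerLaw : Prop :=
  open Literature.MathematicalPhysics.QuantumLattice Literature.Barriers.HubbardSuperconductivity Literature.Probability.LatticeModels in ∃ U₀ C₀ : ℝ, 0 < C₀ ∧ ∀ (g : Site 2 → ℝ) (U β : ℝ), U₀ ≤ U → 0 < β → ∃ S : Set ℝ, S.Countable ∧ ∀ μ : ℝ, μ ∉ S → ∃ C : ℝ, ∀ (L : ℕ) [NeZero L] (x y : TorusSite 2 L), |thermalPairFieldCorr g β 1 U μ L x y| ≤ C * ((torusDist x y : ℝ) + 1) ^ (-pairDecayExponent (β / 2 * min 2 (C₀ * (|1 - (Matrix.gibbsState β (hubbardTorusWith 2 L 1 U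 μ) totalNumber).re / (L : ℝ) ^ 2| + 1 / U + Real.sqrt (1 / (β * U))))))

/-- item stmt-HubbardSuperconductivity-8293 · crux · rank 2 · closed · moot by None · by planner
why it might fail: ALL |∇φ|≤1, C uniform in L, φ: at tight k the first-order slack is 0, so the bond-kinetic Duhamel structure factor must stay bounded at EVERY wavevector uniformly in L; a floating incommensurate-stripe μ-window at low T (arXiv:2009.10736) makes S(U,β) uncountable; control only at βt≪1 (Ueltschi1999)
sources: KomaTasakiPRL1992, McBryanSpencer1977, Ueltschi1999, EmeryKivelsonLin1990, arXiv:2009.10736, arXiv:1612.05211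
[crux] HOMOGENIZATION (card K1/Theorem 2, in the weakest form the assembly needs): for U ≥ U₀, β > 0
and μ outside a countable set there is C such that for every side L, every k bounding the undeformed
bond kinetic expectations ‖⟨Σ_σ c†_{uσ}c_{vσ}⟩_{β,L,μ}‖ ≤ k on adjacent (u,v), and every site
function φ with |φ_u − φ_v| ≤ 1 on edges, the cosh-enhanced-hopping model K_φ = H − T(cosh∇φ − 1)
satisfies log Z(K_φ) − log Z(H) ≤ β·k·Σ_{u∼v}(cosh(φ_u−φ_v) − 1) + C(1 + Σ_{u∼v}(cosh(φ_u−φ_v) −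
1)²): the deformation costs free energy at the rate of the HOMOGENEOUS kinetic budget, up to an
R-independent remainder (for the radial test potentials Σw ~ q² log R but Σw² = O(q⁴)). Attack
lines: (a) Duhamel to second order, remainder ≤ β²χ Σw²/2 with χ the ℓ¹-norm of the connected
bond–bond Duhamel function along H + sV_φ (converges even at a power-law critical point because w_b
~ q²/r²); (b) endpoint Peierls–Bogoliubov + local KMS/energy–entropy-balance bounds on doublons and
doublon–hole pairs of the deformed state + "no mesoscopic hole accumulation at the vortex cores"
(finite compressibility). [difficulty: open-problem] -/
@[route_item "route-HubbardSuperconductivity-KineticMerminWagner"]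
def DeformationFreeEnergy : Prop :=
  open Literature.MathematicalPhysics.QuantumLattice in ∃ U₀ : ℝ, ∀ (U β : ℝ), U₀ ≤ U → 0 < β → ∃ S : Set ℝ, S.Countable ∧ ∀ μ : ℝ, μ ∉ S → ∃ C : ℝ, ∀ (L : ℕ) [NeZero L] (k : ℝ), (∀ u v : FermionTorus 2 L, (fermionTorusGraph 2 L).Adj u v → ‖Matrix.gibbsState β (hubbardTorusWith 2 L 1 U μ) (∑ σ : Fin 2, creation (orb u σ) * annihilation (orb v σ))‖ ≤ k) → ∀ φ : FermionTorus 2 L → ℝ, (∀ u v : FermionTorus 2 L, (fermionTorusGraph 2 L).Adj u v → |φ u - φ v| ≤ 1) → Real.log (Matrix.partitionFn β (hubbardTorusWith 2 L 1 U μ - hoppingForm (fermionTorusGraph 2 L) (fun a b => Real.cosh (φ a - φ b) - 1))).re ≤ Real.log (Matrix.partitionFn β (hubbardTorusWith 2 L 1 U μ)).re + β * k * (∑ u : FermionTorus 2 L, ∑ v : FermionTorus 2 L, if (fermionTorusGraph 2 L).Adj u v then (Real.cosh (φ u - φ v) - 1) else 0) + C * (1 + ∑ u : FermionTorus 2 L,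 ∑ v : FermionTorus 2 L, if (fermionTorusGraph 2 L).Adj u v then (Real.cosh (φ u - φ v) - 1) ^ 2 else 0)

/-- item stmt-HubbardSuperconductivity-8294 · support · rank 3 · closed · moot by None · by planner
why it might fail: The δ-LINEAR law needs the doublon grading with pre/post projectors placed right in all four channels (else only √δ survives), the Schur floor on each (N,D) block, the bondwise square completion at U ≥ 32t, and torus translation invariance of the fermionic Gibbs state (JW signs).
sources: Tasaki1998, ZhangGrosRiceShiba1988, BratteliRobinsonII1997, Simon1993, HazraVermaRanderia2019, DattaFernandezFrohlich1999
[crux] THERMAL KINETIC CEILING (card Theorem 3, both signs of doping, every L, grand-canonical):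
there are U₀, C₁ with ‖⟨Σ_σ c†_{uσ}c_{vσ}⟩_{β,L,μ}‖ ≤ C₁(|δ_L| + 1/U + (1/(βU))^{1/2}) for all U ≥
U₀ (t = 1), μ, β > 0, L and adjacent (u,v), δ_L = 1 − ⟨N̂⟩/L². Sketch: (i) per bond and spin, split
c†_{uσ}c_{vσ} by the σ̄-occupations of u,v (four commuting channels: hole moves, doublon moves, pair
creation, pair annihilation) and Cauchy–Schwarz with the pre/post projectors: |⟨c†_{uσ}c_{vσ}⟩| ≤
(h_u+h_v)/2 + (d_u+d_v)/2 + √⟨D_u h_v⟩ + √⟨h_u D_v⟩ in ANY state; (ii) h = 1 − n + d sitewise; (iii)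
operator floor H ≥ −4(L² − N̂) + (U/2 − 8)D̂ − 256L²/U (doublon grading of the hopping: Schur test
T₀ ≥ −4(Ê + D̂) on each (N,D) block; bondwise X_b + X_b† ≥ −aX_b†X_b − 1/a with X_b†X_b ≤
16(D_u+D_v), a = U/128) and its particle–hole mirror H ≥ (U−4)(N̂ − L²) + (U/2 − 8)Ê − 256L²/U; (iv)
Gibbs variational principle against the atomic limit, F(K) ≤ F(K₀) ≤ −μ⟨N̂⟩ + U(⟨N̂⟩ − L²)⁺
(Peierls–Bogoliubov with ⟨T̂⟩_{K₀} = 0, then z₀ ≥ each of its terms), and S(ω) ≤ L² ln 4 ⇒ d (resp.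
h) ≤ (4|δ_L| + T ln 4 + 256/U)/(U/2 − 8); (v) translation invariance of the torus Gibbs state turns
site/bond quantities i -/
@[route_item "route-HubbardSuperconductivity-KineticMerminWagner"]
def ThermalKineticCeiling : Prop :=
  open Literature.MathematicalPhysics.QuantumLattice in ∃ U₀ C₁ : ℝ, ∀ (U μ β : ℝ), U₀ ≤ U → 0 < β → ∀ (L : ℕ) [NeZero L] (u v : FermionTorus 2 L), (fermionTorusGraph 2 L).Adj u v → ‖Matrix.gibbsState β (hubbardTorusWith 2 L 1 U μ) (∑ σ : Fin 2, creation (orb u σ) * annihilation (orb v σ))‖ ≤ C₁ * (|1 - (Matrix.gibbsState β (hubbardTorusWith 2 L 1 U μ) totalNumber).re / (L : ℝ) ^ 2| + 1 / U + Real.sqrt (1 / (β * U)))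

/-- item stmt-HubbardSuperconductivity-8295 · support · rank 4 · closed · moot by None · by planner
why it might fail: True unless mis-stated: PB needs H − tT(w) Hermitian (w symmetric) and the sign −β·re⟨V_φ⟩ at the DEFORMED state; ordered-pair bookkeeping fixes b = β|t|k/2 (k = 2 must recover the tree); the radial potential's gradient ≤ 1 needs q ≤ 1 and the 1-Lipschitz torus norm.
sources: KomaTasakiPRL1992, McBryanSpencer1977, FrohlichUeltschi2015, BenassiFroehlichUeltschi2016, Simon1993, Ruelle1969
[crux] KINETIC KOMA–TASAKI (card Theorem 1, unconditional): for every form factor g, all t, U, μ, β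
≥ 0, every side L and every k ≥ 0 bounding the bond kinetic expectations ‖⟨Σ_σ c†_{uσ}c_{vσ}⟩‖ of
the Gibbs states of ALL cosh-deformed Hamiltonians H − tT(cosh∇φ − 1) with |∇φ| ≤ 1 on edges:
|⟨(P_x)†P_y⟩_{β,L}| ≤ C_g (dist(x,y)+1)^{−f(β|t|k/2)} with the tree's C_g = pairFieldDecayConst g
and f = pairDecayExponent (k = 2 is the tree's theorem; every kinetic ceiling on the deformed family
improves the EXPONENT proportionally). Proof: GaugeRatioBound + PeierlsBogoliubov in place of
‖e^{−βV}‖ ≤ e^{β‖V‖} inside the barrier file's norm_thermalCorr_bondPair_torus_le (radial potential: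
φ_x − φ_y = qH(R), Σ_{u∼v} w ≤ 64q²H(R), |∇φ| ≤ q ≤ 1), then −β⟨V_φ⟩_{K_φ} = βt Σ_{u∼v} w(u,v)
re⟨Σ_σ c†_u c_v⟩_{K_φ} ≤ β|t| k Σ w. [deps: GaugeRatioBound, PeierlsBogoliubov] [difficulty: M] -/
@[route_item "route-HubbardSuperconductivity-KineticMerminWagner"]
def KineticKomaTasaki : Prop :=
  open Literature.MathematicalPhysics.QuantumLattice Literature.Barriers.HubbardSuperconductivity Literature.Probability.LatticeModels in ∀ (g : Site 2 → ℝ) (t U μ β : ℝ), 0 ≤ β → ∀ (k : ℝ), 0 ≤ k → ∀ (L : ℕ) [NeZero L], (∀ φ : FermionTorus 2 L → ℝ, (∀ u v : FermionTorus 2 L, (fermionTorusGraph 2 L).Adj u v → |φ u - φ v| ≤ 1) → ∀ u v : FermionTorus 2 L, (fermionTorusGraph 2 L).Adj u v → ‖Matrix.gibbsState β (hubbardTorusWith 2 L t U μ - (t : ℂ) • hoppingForm (fermionTorusGraph 2 L) (fun a b => Real.cosh (φ a - φ b) - 1)) (∑ σ : Fin 2, creation (orb u σ) * annihilation (orb v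 σ))‖ ≤ k) → ∀ x y : TorusSite 2 L, ‖(hubbardTorusWith 2 L t U μ).thermalCorr β (localPair g L x)ᴴ (localPair g L y)‖ ≤ pairFieldDecayConst g * ((torusDist x y : ℝ) + 1) ^ (-pairDecayExponent (β * |t| * k / 2))

/-- item stmt-HubbardSuperconductivity-8296 · support · rank 9 · closed · moot by None · by planner
sources: KomaTasakiPRL1992, FrohlichUeltschi2015, Bernstein2009, Petz1994
[support] (M1, partition-function form of the Koma–Tasaki gauge bound; the tree's
norm_gibbsState_le_of_gauge stopped one step earlier) H Hermitian, D invertible, DAD⁻¹ = κA, DHD⁻¹ +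
(DHD⁻¹)ᴴ = 2(H + V), β ≥ 0 ⇒ ‖⟨A⟩_{β,H}‖·Z(H) ≤ |κ|‖A‖·Z(H+V) (trace cyclicity + Schwarz + Bernstein
Tr e^X e^{Xᴴ} ≤ Tr e^{X+Xᴴ}: the anti-Hermitian part is deleted exactly; the intermediate `have`s of
norm_trace_mul_exp_le_of_hermitianPart_le, exported). [difficulty: provable-now] -/
@[route_item "route-HubbardSuperconductivity-KineticMerminWagner"]
def GaugeRatioBound : Prop :=
  open scoped Matrix.Norms.L2Operator in ∀ (n : Type) [Fintype n] [DecidableEq n] (H A D V : Matrix n n ℂ), H.IsHermitian → IsUnit D → ∀ κ : ℂ, D * A * D⁻¹ = κ • A → D * H * D⁻¹ + (D * H * D⁻¹)ᴴ = (2 : ℂ) • (H + V) → ∀ β : ℝ, 0 ≤ β → ‖Matrix.gibbsState β H A‖ * (Matrix.partitionFn β H).re ≤ ‖κ‖ * ‖A‖ * (Matrix.partitionFn β (H + V)).re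

/-- item stmt-HubbardSuperconductivity-8297 · support · rank 9 · closed · moot by None · by planner
sources: Ruelle1969, Simon1993, BratteliRobinsonII1997
[support] (M2) Peierls–Bogoliubov / Gibbs–Bogoliubov inequality for Hermitian matrices: Z_β(H+V) ≤
Z_β(H)·exp(−β re⟨V⟩_{β,H+V}) (Peierls' Tr e^M ≥ Σ_i e^{⟨i|M|i⟩} in the eigenbasis of H+V, then
Jensen). Used by KineticKomaTasaki, by ThermalKineticCeiling (F(K) ≤ F(K₀)), and by attack (b) on
DeformationFreeEnergy; reusable by ThermalWedge-type routes. [difficulty: provable-now] -/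
@[route_item "route-HubbardSuperconductivity-KineticMerminWagner"]
def PeierlsBogoliubov : Prop :=
  ∀ (n : Type) [Fintype n] [DecidableEq n] (H V : Matrix n n ℂ), H.IsHermitian → V.IsHermitian → ∀ β : ℝ, 0 ≤ β → (Matrix.partitionFn β (H + V)).re ≤ (Matrix.partitionFn β H).re * Real.exp (-(β * (Matrix.gibbsState β (H + V) V).re))

/-- item stmt-HubbardSuperconductivity-8298 · assembly · rank 1 · closed · moot by None · by planner
sources: KomaTasakiPRL1992, McBryanSpencer1977
[assembly] GaugeRatioBound → DeformationFreeEnergy → ThermalKineticCeiling → KineticMerminWagnerLaw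
(ceiling route: concludes the route target, deliberately not the summit constant; see § Thesis). -/
@[route_item "route-HubbardSuperconductivity-KineticMerminWagner"]
def Assembly : Prop :=
  GaugeRatioBound → DeformationFreeEnergy → ThermalKineticCeiling → KineticMerminWagnerLaw

end Summit.HubbardSuperconductivity.HubbardSuperconductivity.Theses.KineticMerminWagner
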